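import Summits.QuantumFields.YangMills.Theorems.LuscherReductionTwistedTraceScalingBOStiffNearProductRecord
import Summits.QuantumFields.YangMills.Theorems.LuscherReductionTwistedTraceScalingBOStiffDefs
import Summits.QuantumFields.YangMills.Theorems.LuscherReductionTwistedTraceScalingBOStiffSlowOp
import HarnessLib

/-!
# (B-ST) (W1-6) `…BOStiffNearSchedule`: the `hnear` and `hkop` inputs of `form_le_of_product_near` on the record schedule, with `M := cM L β`
# (lane A of S-BASE, crux `TwistedTraceScaling` stmt-QuantumFields-20203, C4-CORE, the (B-ST) pen; HANDOFF-g21 UPDATE 20:39Z (W1-6))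

The slow ⊗ fibre assembly `…BOStiffSlowAssembly.form_le_of_product_near` on `(U,ν) = (GaugeConfig 3 1 SU2, σ³)`, `(X,μ) = (fibre, orthoTransverse L)` wants
`hnear : ∀ p q, |G p q − k p.1 q.1·M p.2 q.2| ≤ η_t·(k p.1 q.1·M p.2 q.2) + τ` and `hkop` for `k`.  Here `M := cM L β` (✓`…BOStiffDefs`, the central based kernel),
`k u u' := K₁^{(L³β)}(u,u')/K₁(1,1)` (unwindowed) and `G` is the based tube kernel ON THE RECORD WINDOWS and `k·M` OFF them:
`G_β p q := if (slow data in the window `‖q(u_k) − 1‖ ≤ Dδβ^{-s}`, fibre data in the cap with `‖x̂‖ ≤ r_f`) then ∫ K_β(oT p, (oT q)^{bE h}) dh else k p.1 q.1·cM p.2 q.2`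
(the record test function lives on the windows, so the pair form `∫∫ v G_β v` is the true one — (W1-7)).
* §1 ★★ `eventually_schedule_hnear_full` / `eventually_basedKernel_product_near_full` — ✓`…BOStiffNearProductRecord` re-run at the FULL fibre radius `R = r_f` (the support radius of `cΘ`,
  so that `cS ⊆ window`): `|G − ρ·cM| ≤ ε·ρ·cM + e^{2β|E|}·4e^{−ℓ²}` on the windows, any `ε > 0`, eventually.
* §2 ★★★ `hnear_record` — the literal `hnear` for `G_β`, `k`, `cM`: `∀ ε > 0, ∀ᶠ β, ∀ p q, |G_β p q − k p.1 q.1·cM β p.2 q.2| ≤ ε·(k p.1 q.1·cM β p.2 q.2) + e^{2β|E|}·4e^{−ℓ²}`.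
* §3 ★★ `hkop_record` — the literal `hkop` for `k` with `κ₀ = topValue su2Rep 1 (L³β)/K₁(1,1)` (✓`…BOStiffSlowOp.hkop_oneSite`).
HONEST FRAMING: elementary inequalities for a stub of a child of the CONDITIONAL route R2b1; (B-ST) OPEN; C4-CORE OPEN; not infinite volume, not a gap, not Clay.
-/

set_option autoImplicit false

noncomputable section

open MeasureTheory Filter Topology Real
open scoped BigOperators
open Literature.MathematicalPhysics.QuantumFieldTheory
open Literature.MathematicalPhysics.QuantumLattice

namespace Summit.QuantumFields.YangMills.Theorems.FemtoTransferGap.TwoLattice.ConstTube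

open Summit.QuantumFields.YangMills.Theorems.FemtoTransferGap
open Summit.QuantumFields.YangMills.Theorems.FemtoTransferGap.TwoLattice
open Summit.QuantumFields.YangMills.Theorems.FemtoTransferGap.TwoLattice.Avg
open Summit.QuantumFields.YangMills.Theorems.FemtoTransferGap.TwoLattice.Stiff (LinkSpace)
open Summit.QuantumFields.YangMills.Theorems.TwistedTraceScaling.Negative

variable {L : ℕ} [NeZero L]

/-! ## §1 The schedule at the full fibre radius -/

set_option maxHeartbeats 1600000 in
-- many elementary real inequalities.
/-- ★★ **THE NUMERICS OF THE SCHEDULE, full fibre radius `R = r_f`**: eventually in `β`, with `T = β^{-1/2}ℓ³`, `α = T/(12L)`, `R = r_f`, `δ = Dδ·β^{-s}` (`Dδ ≥ 0`, `s > 0`), `ℓ = btLog β`: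
`δ ≤ 1/2`, `α ≤ 1`, `T ≤ 1/30`, `12L³δ⁴ < 2`, `R ≤ T`, `12L(√2R+δ) ≤ 1`, `2√2R + α ≤ T/(6L)`, the far margin `m₀ ≥ 0`, the three tail exponents are `≥ ℓ²`, `βT² ≤ ℓ⁶`, `βR² ≤ ℓ²`,
and `K·(δ+T)ℓ⁶ ≤ min 1 (ε/2)` for any real `K` and `ε > 0`. [folklore] -/
theorem eventually_schedule_hnear_full {s : ℝ} (hs : 0 < s) {Dδ : ℝ} (hD : 0 ≤ Dδ) (K : ℝ) {ε : ℝ} (hε : 0 < ε) :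
    ∀ᶠ β : ℝ in atTop,
      0 ≤ β ∧ Dδ * powScale s β ≤ 1 / 2 ∧ powScale (1 / 2) β * btLog β ^ 3 / (12 * L) ≤ 1 ∧ powScale (1 / 2) β * btLog β ^ 3 ≤ 1 / 30 ∧
      12 * (L : ℝ) ^ 3 * (Dδ * powScale s β) ^ 4 < 2 ∧ min (1 / 40) (powScale (1 / 2) β * btLog β) ≤ powScale (1 / 2) β * btLog β ^ 3 ∧
      12 * L * (Real.sqrt 2 * (min (1 / 40) (powScale (1 / 2) β * btLog β)) + Dδ * powScale s β) ≤ 1 ∧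
      2 * Real.sqrt 2 * (min (1 / 40) (powScale (1 / 2) β * btLog β)) + powScale (1 / 2) β * btLog β ^ 3 / (12 * L) ≤ powScale (1 / 2) β * btLog β ^ 3 / (6 * L) ∧
      0 ≤ L * (1 - (L - 1) * (Dδ * powScale s β)) * (powScale (1 / 2) β * btLog β ^ 3 / (12 * L)) -
          L * (Real.sqrt 2 * (min (1 / 40) (powScale (1 / 2) β * btLog β) + min (1 / 40) (powScale (1 / 2) β * btLog β))) ∧
      btLog β ^ 2 ≤ β * (powScale (1 / 2) β * btLog β ^ 3 / (6 * L) - (2 * Real.sqrt 2 * (min (1 / 40) (powScale (1 / 2) β * btLog β)) + powScale (1 / 2) β * btLog β ^ 3 / (12 * L))) ^ 2 ∧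
      btLog β ^ 2 ≤ β * ((L * (1 - (L - 1) * (Dδ * powScale s β)) * (powScale (1 / 2) β * btLog β ^ 3 / (12 * L)) -
          L * (Real.sqrt 2 * (min (1 / 40) (powScale (1 / 2) β * btLog β) + min (1 / 40) (powScale (1 / 2) β * btLog β)))) ^ 2 / L) ∧
      btLog β ^ 2 ≤ (L : ℝ) ^ 3 * β * (powScale (1 / 2) β * btLog β ^ 3 / (12 * L)) ^ 2 ∧
      β * (powScale (1 / 2) β * btLog β ^ 3) ^ 2 ≤ btLog β ^ 6 ∧ β * (min (1 / 40) (powScale (1 / 2) β * btLog β)) ^ 2 ≤ btLog β ^ 2 ∧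
      K * ((Dδ * powScale s β + powScale (1 / 2) β * btLog β ^ 3) * btLog β ^ 6) ≤ min 1 (ε / 2) := by
  have hL1 : (1 : ℝ) ≤ L := by exact_mod_cast NeZero.one_le
  have hL0 : (0 : ℝ) < L := by linarith
  -- the small quantities and their limits
  have tδ : Tendsto (fun β : ℝ => Dδ * powScale s β) atTop (𝓝 0) := by simpa using (tendsto_powScale hs).const_mul Dδ
  have tT : Tendsto (fun β : ℝ => powScale (1 / 2) β * btLog β ^ 3) atTop (𝓝 0) := tendsto_powScale_mul_btLog_pow (p := 1 / 2) (by norm_num) 3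
  have tT9 : Tendsto (fun β : ℝ => powScale (1 / 2) β * btLog β ^ 9) atTop (𝓝 0) := tendsto_powScale_mul_btLog_pow (p := 1 / 2) (by norm_num) 9
  have tδ6 : Tendsto (fun β : ℝ => powScale s β * btLog β ^ 6) atTop (𝓝 0) := tendsto_powScale_mul_btLog_pow hs 6
  have trf : Tendsto (fun β : ℝ => powScale (1 / 2) β * btLog β) atTop (𝓝 0) := by
    simpa only [pow_one] using tendsto_powScale_mul_btLog_pow (p := 1 / 2) (by norm_num) 1
  have tσ : Tendsto (fun β : ℝ => 12 * (L : ℝ) ^ 3 * (Dδ * powScale s β) ^ 4) atTop (𝓝 0) := by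
    have h := (tδ.pow 4).const_mul (12 * (L : ℝ) ^ 3); simpa using h
  have tLa : Tendsto (fun β : ℝ => 12 * L * Real.sqrt 2 * (powScale (1 / 2) β * btLog β) + 12 * L * (Dδ * powScale s β)) atTop (𝓝 0) := by
    have h := (trf.const_mul (12 * (L : ℝ) * Real.sqrt 2)).add (tδ.const_mul (12 * (L : ℝ))); simpa using h
  have tKW : Tendsto (fun β : ℝ => K * ((Dδ * powScale s β + powScale (1 / 2) β * btLog β ^ 3) * btLog β ^ 6)) atTop (𝓝 0) := by
    have h := ((tδ6.const_mul Dδ).add tT9).const_mul K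
    rw [mul_zero, zero_add, mul_zero] at h
    refine h.congr' (Eventually.of_forall fun β => ?_)
    ring
  have hmin : 0 < min 1 (ε / 2) := lt_min one_pos (by positivity)
  have tℓ2 : Tendsto (fun β : ℝ => btLog β ^ 2) atTop atTop :=
    (Filter.Tendsto.atTop_mul_atTop₀ tendsto_btLog_atTop tendsto_btLog_atTop).congr' (Eventually.of_forall fun β => by ring)
  filter_upwards [eventually_ge_atTop (1 : ℝ), tδ.eventually (eventually_le_nhds (by norm_num : (0:ℝ) < 1 / 2)),
    tT.eventually (eventually_le_nhds (by norm_num : (0:ℝ) < 1 / 30)), tσ.eventually (eventually_lt_nhds (by norm_num : (0:ℝ) < 2)),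
    trf.eventually (eventually_le_nhds (by norm_num : (0:ℝ) < 1 / 40)), tLa.eventually (eventually_le_nhds (by norm_num : (0:ℝ) < 1)),
    tℓ2.eventually_ge_atTop (96 * Real.sqrt 2 * L + 576 * (L : ℝ) ^ 2 + 2304 * L + 144),
    tKW.eventually (eventually_le_nhds hmin), eventually_beta_mul_rf_sq] with β hβ1 hδ hT30 hσ hrf40 hLa hℓbig hKW hrf2
  set ℓ := btLog β with hℓdef
  set p := powScale (1 / 2) β with hpdef
  set δ := Dδ * powScale s β with hδdef
  set rf := min (1 / 40) (p * ℓ) with hrfdef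
  have hβ0 : 0 ≤ β := by linarith
  have hℓ1 : 1 ≤ ℓ := one_le_btLog β
  have hℓ0 : 0 ≤ ℓ := by linarith
  have hp0 : 0 < p := powScale_pos _ _
  have hδ0 : 0 ≤ δ := mul_nonneg hD (powScale_pos _ _).le
  have hβp : β * p ^ 2 = 1 := mul_powScale_half_sq hβ1
  have hrf_eq : rf = p * ℓ := min_eq_right hrf40
  have hs20 : 0 ≤ Real.sqrt 2 := Real.sqrt_nonneg 2
  -- the two fibre scales `Y = pℓ = r_f`, `X = pℓ³ = T`, `X = Y·ℓ²`
  set X : ℝ := p * ℓ ^ 3 with hXdef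
  set Y : ℝ := p * ℓ with hYdef
  have hX0 : 0 ≤ X := by positivity
  have hY0 : 0 ≤ Y := by positivity
  have hXY : X = Y * ℓ ^ 2 := by rw [hXdef, hYdef]; ring
  have hℓ2 : 96 * Real.sqrt 2 * L + 576 * (L : ℝ) ^ 2 + 2304 * L + 144 ≤ ℓ ^ 2 := hℓbig
  have h48 : 96 * Real.sqrt 2 * L ≤ ℓ ^ 2 := by nlinarith [sq_nonneg (L : ℝ)]
  have hkey : Real.sqrt 2 * Y ≤ X / (96 * L) := by
    rw [le_div_iff₀ (by positivity), hXY]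
    have h := mul_le_mul_of_nonneg_left h48 hY0
    nlinarith [h]
  have hX48 : 0 ≤ X / (96 * L) := by positivity
  have hRT : rf ≤ X := by
    rw [hrf_eq]
    have h1 : Y ≤ X := by
      rw [hXY]; have : Y * 1 ≤ Y * ℓ ^ 2 := mul_le_mul_of_nonneg_left (one_le_pow₀ hℓ1) hY0
      linarith
    exact h1
  have hα1 : X / (12 * L) ≤ 1 := (div_le_self hX0 (by linarith)).trans (by linarith)
  have hTb : 2 * Real.sqrt 2 * rf + X / (12 * L) ≤ X / (6 * L) := by
    rw [hrf_eq]
    have e : X / (6 * L) = X / (12 * L) + 8 * (X / (96 * L)) := by field_simp; ring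
    have e2 : 2 * Real.sqrt 2 * (p * ℓ) = 2 * (Real.sqrt 2 * Y) := by rw [hYdef]; ring
    rw [e, e2]; linarith
  have hLa' : 12 * L * (Real.sqrt 2 * rf + δ) ≤ 1 := by
    have e : 12 * (L : ℝ) * (Real.sqrt 2 * rf + δ) = 12 * L * Real.sqrt 2 * (p * btLog β) + 12 * L * δ := by rw [hrf_eq]; ring
    rw [e]; exact hLa
  -- the far margin `m₀ ≥ X/48`
  have hLδ : (L - 1 : ℝ) * δ ≤ 1 / 2 := by
    have h12 : 12 * (L : ℝ) * δ ≤ 1 := by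
      have : 0 ≤ 12 * (L : ℝ) * (Real.sqrt 2 * rf) := by rw [hrf_eq]; positivity
      nlinarith [hLa']
    nlinarith [mul_nonneg hL0.le hδ0]
  have hm₀ : X / 48 ≤ L * (1 - (L - 1) * δ) * (X / (12 * L)) - L * (Real.sqrt 2 * (rf + rf)) := by
    rw [hrf_eq]
    have e1 : (L : ℝ) * (1 - (L - 1) * δ) * (X / (12 * L)) = (1 - (L - 1) * δ) * X / 12 := by field_simp
    have h1 : X / 24 ≤ (1 - (L - 1) * δ) * X / 12 := by
      rw [div_le_div_iff₀ (by norm_num) (by norm_num)]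
      nlinarith [mul_nonneg (sub_nonneg.mpr (show (L - 1 : ℝ) * δ ≤ 1 / 2 from hLδ)) hX0]
    have e2 : (L : ℝ) * (Real.sqrt 2 * (p * ℓ + p * ℓ)) = 2 * (L * (Real.sqrt 2 * Y)) := by rw [hYdef]; ring
    have h2 : (L : ℝ) * (Real.sqrt 2 * Y) ≤ L * (X / (96 * L)) := mul_le_mul_of_nonneg_left hkey hL0.le
    have e3 : (L : ℝ) * (X / (96 * L)) = X / 96 := by field_simp
    rw [e1, e2]; linarith
  have hm₀0 : 0 ≤ L * (1 - (L - 1) * δ) * (X / (12 * L)) - L * (Real.sqrt 2 * (rf + rf)) := le_trans (by positivity) hm₀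
  -- `βX² = ℓ⁶` and the three exponents
  have hℓ6 : β * X ^ 2 = ℓ ^ 6 := by
    calc β * X ^ 2 = (β * p ^ 2) * ℓ ^ 6 := by rw [hXdef]; ring
      _ = ℓ ^ 6 := by rw [hβp, one_mul]
  have hℓ24 : ℓ ^ 2 ≤ ℓ ^ 4 := pow_le_pow_right₀ hℓ1 (by norm_num)
  have hℓ4a : 576 * (L : ℝ) ^ 2 * ℓ ^ 2 ≤ ℓ ^ 6 := by
    have h1 : 576 * (L : ℝ) ^ 2 ≤ ℓ ^ 2 := by nlinarith
    calc 576 * (L : ℝ) ^ 2 * ℓ ^ 2 ≤ ℓ ^ 2 * ℓ ^ 2 * ℓ ^ 2 / ℓ ^ 2 * 1 := by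
          rw [mul_div_assoc, div_self (by positivity), mul_one, mul_one]; exact mul_le_mul_of_nonneg_right h1 (by positivity)
      _ ≤ ℓ ^ 6 := by rw [mul_div_assoc, div_self (by positivity), mul_one, mul_one]; nlinarith [hℓ24]
  have hℓ4b : 2304 * (L : ℝ) * ℓ ^ 2 ≤ ℓ ^ 6 := by
    have h1 : 2304 * (L : ℝ) ≤ ℓ ^ 2 := by nlinarith [sq_nonneg (L : ℝ)]
    have h2 : 2304 * (L : ℝ) * ℓ ^ 2 ≤ ℓ ^ 2 * ℓ ^ 2 := mul_le_mul_of_nonneg_right h1 (by positivity)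
    nlinarith [mul_le_mul_of_nonneg_right hℓ24 (show (0:ℝ) ≤ ℓ ^ 2 by positivity)]
  have hℓ4c : 144 * ℓ ^ 2 ≤ (L : ℝ) * ℓ ^ 6 := by
    have h1 : 144 ≤ ℓ ^ 2 := by nlinarith [sq_nonneg (L : ℝ)]
    have h2 : 144 * ℓ ^ 2 ≤ ℓ ^ 2 * ℓ ^ 2 := mul_le_mul_of_nonneg_right h1 (by positivity)
    have h3 : ℓ ^ 2 * ℓ ^ 2 ≤ ℓ ^ 6 := by nlinarith [mul_le_mul_of_nonneg_right hℓ24 (show (0:ℝ) ≤ ℓ ^ 2 by positivity)]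
    have h4 : ℓ ^ 6 ≤ (L : ℝ) * ℓ ^ 6 := le_mul_of_one_le_left (by positivity) hL1
    linarith
  have hexp1 : ℓ ^ 2 ≤ β * (X / (6 * L) - (2 * Real.sqrt 2 * rf + X / (12 * L))) ^ 2 := by
    have hlow : X / (24 * L) ≤ X / (6 * L) - (2 * Real.sqrt 2 * rf + X / (12 * L)) := by
      rw [hrf_eq]
      have e : X / (6 * L) - X / (12 * L) - X / (24 * L) = 4 * (X / (96 * L)) := by field_simp; ring
      have e2 : 2 * Real.sqrt 2 * (p * ℓ) = 2 * (Real.sqrt 2 * Y) := by rw [hYdef]; ring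
      rw [e2]; linarith
    have hsq := pow_le_pow_left₀ (by positivity) hlow 2
    have e3 : β * (X / (24 * L)) ^ 2 = β * X ^ 2 / (576 * L ^ 2) := by field_simp; ring
    calc ℓ ^ 2 ≤ β * (X / (24 * L)) ^ 2 := by rw [e3, hℓ6, le_div_iff₀ (by positivity)]; linarith
      _ ≤ _ := mul_le_mul_of_nonneg_left hsq hβ0
  have hexp2 : ℓ ^ 2 ≤ β * ((L * (1 - (L - 1) * δ) * (X / (12 * L)) - L * (Real.sqrt 2 * (rf + rf))) ^ 2 / L) := by
    have hsq := pow_le_pow_left₀ (by positivity) hm₀ 2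
    have e3 : β * ((X / 48) ^ 2 / L) = β * X ^ 2 / (2304 * L) := by field_simp; ring
    calc ℓ ^ 2 ≤ β * ((X / 48) ^ 2 / L) := by rw [e3, hℓ6, le_div_iff₀ (by positivity)]; linarith
      _ ≤ _ := mul_le_mul_of_nonneg_left (div_le_div_of_nonneg_right hsq hL0.le) hβ0
  have hexp3 : ℓ ^ 2 ≤ (L : ℝ) ^ 3 * β * (X / (12 * L)) ^ 2 := by
    have e3 : (L : ℝ) ^ 3 * β * (X / (12 * L)) ^ 2 = L * (β * X ^ 2) / 144 := by field_simp; ring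
    rw [e3, hℓ6, le_div_iff₀ (by norm_num)]; linarith
  have hβR : β * rf ^ 2 ≤ ℓ ^ 2 := le_of_eq hrf2
  exact ⟨hβ0, hδ, hα1, hT30, hσ, hRT, hLa', hTb, hm₀0, hexp1, hexp2, hexp3, le_of_eq hℓ6, hβR, hKW⟩

set_option maxHeartbeats 1600000 in
-- long record expressions.
/-- ★★ **THE `hnear` GLUE ON THE FULL FIBRE WINDOW, eventually in `β`**: for `s > 0`, `Dδ ≥ 0` and every `ε > 0`, eventually in `β`, for all slow data `u', u` with
`‖q(u_k) − 1‖ ≤ Dδ·β^{-s}` and fibre data `v', v` in the cap with `‖x̂‖ ≤ r_f` (the whole support radius of the profile `cΘ`):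
`|G(oT u' v', oT u v) − ρ·G₁(v',v)| ≤ ε·(ρ·G₁(v',v)) + e^{2β|E|}·(4e^{−ℓ²})` (`ℓ = btLog β`). [cite: Luscher1983, §3] -/
theorem eventually_basedKernel_product_near_full {s : ℝ} (hs : 0 < s) {Dδ : ℝ} (hD : 0 ≤ Dδ) {ε : ℝ} (hε : 0 < ε) :
    ∀ᶠ β : ℝ in atTop, ∀ (u' u : GaugeConfig 3 1 SU2) (v' v : Edge 3 L → Fin 3 → ℝ), v' ∈ capBalancedSet L → v ∈ capBalancedSet L →
      (∀ k : Fin 3, ‖su2Quat (u' (0, k)) - 1‖ ≤ Dδ * powScale s β) → (∀ k : Fin 3, ‖su2Quat (u (0, k)) - 1‖ ≤ Dδ * powScale s β) →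
      ‖linkEmbed L v'‖ ≤ min (1 / 40) (powScale (1 / 2) β * btLog β) → ‖linkEmbed L v‖ ≤ min (1 / 40) (powScale (1 / 2) β * btLog β) →
        |(∫ h, transferKernel su2Rep β (orthoTube L u' v') (gaugeTransform (basedExt L h) (orthoTube L u v)) ∂basedMeasure L) -
            (transferKernel su2Rep ((L : ℝ) ^ 3 * β) u' u / transferKernel su2Rep ((L : ℝ) ^ 3 * β) (1 : GaugeConfig 3 1 SU2) 1) *
              ∫ h, transferKernel su2Rep β (orthoTube L 1 v') (gaugeTransform (basedExt L h) (orthoTube L 1 v)) ∂basedMeasure L| ≤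
          ε * ((transferKernel su2Rep ((L : ℝ) ^ 3 * β) u' u / transferKernel su2Rep ((L : ℝ) ^ 3 * β) (1 : GaugeConfig 3 1 SU2) 1) *
              ∫ h, transferKernel su2Rep β (orthoTube L 1 v') (gaugeTransform (basedExt L h) (orthoTube L 1 v)) ∂basedMeasure L) +
            Real.exp (β * (2 * (Fintype.card (Edge 3 L) : ℝ))) * (4 * Real.exp (-(btLog β ^ 2))) := by
  set K : ℝ := (Fintype.card (Edge 3 L) : ℝ) * (558 + 192 + 288 + 576) + 216 * Fintype.card (Site 3 L) +
      (Fintype.card (Plaquette 3 L × Fin 3) : ℝ) * (1200 * (L : ℝ) ^ 3 + 5040 + 160 + 145000000) +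
      (Fintype.card (Plaquette 3 L) : ℝ) * (2 * (1728 * (4 * (L : ℝ) ^ 2) + 29376 + 700569) + (29376 + 700569)) with hKdef
  filter_upwards [eventually_schedule_hnear_full (L := L) hs hD K hε] with β hβ u' u v' v hv' hv hδu' hδu hx' hx
  obtain ⟨hβ0, hδ, hα1, hT30, hσ, hRT, hLa, hTb, hm₀0, hexp1, hexp2, hexp3, hA, hB, hKW⟩ := hβ
  set ℓ := btLog β with hℓdef
  set δ := Dδ * powScale s β with hδdef
  set rf := min (1 / 40) (powScale (1 / 2) β * btLog β) with hrfdef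
  set T := powScale (1 / 2) β * ℓ ^ 3 with hTdef
  set α := T / (12 * L) with hαdef
  have hL1 : (1 : ℝ) ≤ L := by exact_mod_cast NeZero.one_le
  have hL0 : (0 : ℝ) < L := lt_of_lt_of_le one_pos hL1
  have hℓ1 : 1 ≤ ℓ := one_le_btLog β
  have hδ0 : 0 ≤ δ := (norm_nonneg _).trans (hδu 0)
  have hδ1 : δ ≤ 1 := by linarith
  have hT0 : 0 ≤ T := mul_nonneg (powScale_pos _ _).le (pow_nonneg (zero_le_one.trans hℓ1) 3)
  have hT1 : T ≤ 1 := by linarith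
  have hα0 : 0 ≤ α := div_nonneg hT0 (by positivity)
  have hαT : α ≤ T := div_le_self hT0 (by linarith)
  -- one-site actions from the window
  have hwin' : ∀ e : Edge 3 1, ‖su2Quat (u' e) - 1‖ ≤ δ := fun e => by
    have he : e = (0, e.2) := by ext <;> simp [Subsingleton.elim e.1 0]
    rw [he]; exact hδu' e.2
  have hwin : ∀ e : Edge 3 1, ‖su2Quat (u e) - 1‖ ≤ δ := fun e => by
    have he : e = (0, e.2) := by ext <;> simp [Subsingleton.elim e.1 0]
    rw [he]; exact hδu e.2
  have hL30 : (0 : ℝ) ≤ (L : ℝ) ^ 3 := by positivity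
  have hS' : (L : ℝ) ^ 3 * wilsonAction su2Rep u' ≤ 12 * (L : ℝ) ^ 3 * δ ^ 4 := by
    have h := mul_le_mul_of_nonneg_left (wilsonAction_one_site_le u' hwin') hL30
    linarith
  have hS : (L : ℝ) ^ 3 * wilsonAction su2Rep u ≤ 12 * (L : ℝ) ^ 3 * δ ^ 4 := by
    have h := mul_le_mul_of_nonneg_left (wilsonAction_one_site_le u hwin) hL30
    linarith
  have hv'T : ∀ (e : Edge 3 L) (c : Fin 3), |v' e c| ≤ T := fun e c => ((R59.abs_entry_le_norm_linkEmbed v' e c).trans hx').trans hRT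
  have hvT : ∀ (e : Edge 3 L) (c : Fin 3), |v e c| ≤ T := fun e c => ((R59.abs_entry_le_norm_linkEmbed v e c).trans hx).trans hRT
  have key := basedKernel_product_near (L := L) hβ0 u' u hv' hv (δ := δ) (α := α) (T := T) (R := rf) (σ := 12 * (L : ℝ) ^ 3 * δ ^ 4)
    hδu' hδu hδ hα0 hα1 hT0 hT30 hσ hS' hS hv'T hx' hvT hx hLa hTb hm₀0
  refine key.trans ?_
  -- the rate: `e^η − 1 ≤ 2η ≤ 2K(δ+T)ℓ⁶ ≤ ε`
  have hη := coreRates_le_of_schedule (L := L) (R := rf) hβ0 hδ0 hδ1 hT0 hT1 hα0 hαT hℓ1 hA hB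
  set η : ℝ := coreEta L β δ α T rf (Fintype.card (Site 3 L) * T) (12 * (L : ℝ) ^ 3 * δ ^ 4) + coreEps1 L β δ T rf +
    coreEps2 L β δ T rf (12 * (L : ℝ) ^ 3 * δ ^ 4) with hηdef
  have hηK : η ≤ K * ((δ + T) * ℓ ^ 6) := hη
  have hη0 : 0 ≤ η := by
    have h1 : 0 ≤ coreEta L β δ α T rf (Fintype.card (Site 3 L) * T) (12 * (L : ℝ) ^ 3 * δ ^ 4) := by
      have := Cov.stepActionErr_nonneg (L := L) (σ := 12 * (L : ℝ) ^ 3 * δ ^ 4) hT0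
      unfold coreEta; positivity
    have h2 : 0 ≤ coreEps1 L β δ T rf := by unfold coreEps1; positivity
    have h3 : 0 ≤ coreEps2 L β δ T rf (12 * (L : ℝ) ^ 3 * δ ^ 4) := by
      have := Cov.stepActionErr_nonneg (L := L) (σ := 12 * (L : ℝ) ^ 3 * δ ^ 4) hT0
      have := Cov.stepActionErr_nonneg (L := L) (σ := 0) hT0
      unfold coreEps2; positivity
    rw [hηdef]; exact add_nonneg (add_nonneg h1 h2) h3
  have hη1 : η ≤ 1 := hηK.trans (hKW.trans (min_le_left _ _))
  have hηε : Real.exp η - 1 ≤ ε := by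
    -- `e^η − 1 ≤ 2η` for `0 ≤ η ≤ 1` (the same elementary bound is `Literature.NumberTheory.Sieve.SquarefreeSums.exp_sub_one_le_two_mul`)
    have h := Real.abs_exp_sub_one_le (x := η) (by rw [abs_of_nonneg hη0]; exact hη1)
    rw [abs_of_nonneg hη0] at h
    have h' : Real.exp η - 1 ≤ 2 * η := (le_abs_self _).trans h
    have h2 : K * ((δ + T) * ℓ ^ 6) ≤ ε / 2 := hKW.trans (min_le_right _ _)
    linarith
  -- the tail: each exponent `≥ ℓ²`
  have ht1 : Real.exp (-(β * (T / (6 * L) - (2 * Real.sqrt 2 * rf + α)) ^ 2)) ≤ Real.exp (-(ℓ ^ 2)) := Real.exp_le_exp.mpr (by linarith)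
  have ht2 : Real.exp (-(β * ((L * (1 - (L - 1) * δ) * α - L * (Real.sqrt 2 * (rf + rf))) ^ 2 / L))) ≤ Real.exp (-(ℓ ^ 2)) :=
    Real.exp_le_exp.mpr (by linarith)
  have ht3 : Real.exp (-((L : ℝ) ^ 3 * β * α ^ 2)) ≤ Real.exp (-(ℓ ^ 2)) := Real.exp_le_exp.mpr (by linarith)
  set ρG : ℝ := transferKernel su2Rep ((L : ℝ) ^ 3 * β) u' u / transferKernel su2Rep ((L : ℝ) ^ 3 * β) (1 : GaugeConfig 3 1 SU2) 1 *
      ∫ h, transferKernel su2Rep β (orthoTube L 1 v') (gaugeTransform (basedExt L h) (orthoTube L 1 v)) ∂basedMeasure L with hρG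
  have hρG0 : 0 ≤ ρG := mul_nonneg (div_pos (transferKernel_pos _ _ _ _) (transferKernel_pos _ _ _ _)).le (basedIntegral_nonneg β _ _)
  have hEK0 : 0 ≤ Real.exp (β * (2 * (Fintype.card (Edge 3 L) : ℝ))) := (Real.exp_pos _).le
  have hsum : 2 * Real.exp (-(β * (T / (6 * L) - (2 * Real.sqrt 2 * rf + α)) ^ 2)) +
      Real.exp (-(β * ((L * (1 - (L - 1) * δ) * α - L * (Real.sqrt 2 * (rf + rf))) ^ 2 / L))) + Real.exp (-((L : ℝ) ^ 3 * β * α ^ 2)) ≤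
      4 * Real.exp (-(ℓ ^ 2)) := by linarith
  exact add_le_add (mul_le_mul_of_nonneg_right hηε hρG0) (mul_le_mul_of_nonneg_left hsum hEK0)

/-! ## §2 ★★★ The literal `hnear` -/

open Classical in

/-- ★★★ **`hnear` OF RECORD**: with `k u u' = K₁(u,u')/K₁(1,1)`, `M = cM L β` and `G_β` the based tube kernel on the record windows (else `k·M`):
`∀ ε > 0, ∀ᶠ β, ∀ p q, |G_β p q − k p.1 q.1·cM β p.2 q.2| ≤ ε·(k p.1 q.1·cM β p.2 q.2) + e^{2β|E|}·4e^{−ℓ²}` (the `if` is classical). [cite: Luscher1983, §3] -/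
theorem hnear_record {s : ℝ} (hs : 0 < s) {Dδ : ℝ} (hD : 0 ≤ Dδ) {ε : ℝ} (hε : 0 < ε) :
    ∀ᶠ β : ℝ in atTop, ∀ p q : GaugeConfig 3 1 SU2 × (Edge 3 L → Fin 3 → ℝ),
      |(if (∀ k : Fin 3, ‖su2Quat (p.1 (0, k)) - 1‖ ≤ Dδ * powScale s β) ∧ (∀ k : Fin 3, ‖su2Quat (q.1 (0, k)) - 1‖ ≤ Dδ * powScale s β) ∧
            p.2 ∈ capBalancedSet L ∧ q.2 ∈ capBalancedSet L ∧ ‖linkEmbed L p.2‖ ≤ min (1 / 40) (powScale (1 / 2) β * btLog β) ∧ ‖linkEmbed L q.2‖ ≤ min (1 / 40) (powScale (1 / 2) β * btLog β)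
          then ∫ h, transferKernel su2Rep β (orthoTube L p.1 p.2) (gaugeTransform (basedExt L h) (orthoTube L q.1 q.2)) ∂basedMeasure L
          else transferKernel su2Rep ((L : ℝ) ^ 3 * β) p.1 q.1 / transferKernel su2Rep ((L : ℝ) ^ 3 * β) (1 : GaugeConfig 3 1 SU2) 1 * cM L β p.2 q.2) -
          transferKernel su2Rep ((L : ℝ) ^ 3 * β) p.1 q.1 / transferKernel su2Rep ((L : ℝ) ^ 3 * β) (1 : GaugeConfig 3 1 SU2) 1 * cM L β p.2 q.2| ≤
        ε * (transferKernel su2Rep ((L : ℝ) ^ 3 * β) p.1 q.1 / transferKernel su2Rep ((L : ℝ) ^ 3 * β) (1 : GaugeConfig 3 1 SU2) 1 * cM L β p.2 q.2) +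
          Real.exp (β * (2 * (Fintype.card (Edge 3 L) : ℝ))) * (4 * Real.exp (-(btLog β ^ 2))) := by
  filter_upwards [eventually_basedKernel_product_near_full (L := L) hs hD hε] with β hβ p q
  by_cases hc : (∀ k : Fin 3, ‖su2Quat (p.1 (0, k)) - 1‖ ≤ Dδ * powScale s β) ∧ (∀ k : Fin 3, ‖su2Quat (q.1 (0, k)) - 1‖ ≤ Dδ * powScale s β) ∧
      p.2 ∈ capBalancedSet L ∧ q.2 ∈ capBalancedSet L ∧ ‖linkEmbed L p.2‖ ≤ min (1 / 40) (powScale (1 / 2) β * btLog β) ∧ ‖linkEmbed L q.2‖ ≤ min (1 / 40) (powScale (1 / 2) β * btLog β)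
  · rw [if_pos hc]
    obtain ⟨h1, h2, h3, h4, h5, h6⟩ := hc
    exact hβ p.1 q.1 p.2 q.2 h3 h4 h1 h2 h5 h6
  · rw [if_neg hc, sub_self, abs_zero]
    have hρ : 0 ≤ transferKernel su2Rep ((L : ℝ) ^ 3 * β) p.1 q.1 / transferKernel su2Rep ((L : ℝ) ^ 3 * β) (1 : GaugeConfig 3 1 SU2) 1 :=
      (div_pos (transferKernel_pos _ _ _ _) (transferKernel_pos _ _ _ _)).le
    have hM : 0 ≤ cM L β p.2 q.2 := basedIntegral_nonneg β _ _
    positivity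

/-! ## §3 ★★ The literal `hkop` -/

omit [NeZero L] in
/-- ★★ **`hkop` OF RECORD**: for `k u u' = K₁^{(L³β)}(u,u')/K₁(1,1)` and `β ≥ 0`,
`∫∫ a(u) k(u,u') b(u') dσ³dσ³ ≤ (topValue su2Rep 1 (L³β)/K₁(1,1))·(√∫a²·√∫b²)` for bounded measurable nonnegative `a, b`. [cite: ReedSimonIV1978, Thm XIII.43] -/
theorem hkop_record {β : ℝ} (hβ : 0 ≤ β) :
    ∀ a b : GaugeConfig 3 1 SU2 → ℝ, Measurable a → Measurable b → (∃ C : ℝ, ∀ u, |a u| ≤ C) → (∃ C : ℝ, ∀ u, |b u| ≤ C) → (∀ u, 0 ≤ a u) → (∀ u, 0 ≤ b u) →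
      ∫ u, ∫ u', a u * (transferKernel su2Rep ((L : ℝ) ^ 3 * β) u u' / transferKernel su2Rep ((L : ℝ) ^ 3 * β) (1 : GaugeConfig 3 1 SU2) 1) * b u'
          ∂configMeasure SU2 1 ∂configMeasure SU2 1 ≤
        topValue su2Rep 1 ((L : ℝ) ^ 3 * β) / transferKernel su2Rep ((L : ℝ) ^ 3 * β) (1 : GaugeConfig 3 1 SU2) 1 *
          (Real.sqrt (∫ u, a u ^ 2 ∂configMeasure SU2 1) * Real.sqrt (∫ u, b u ^ 2 ∂configMeasure SU2 1)) := by
  intro a b ha hb hCa hCb ha0 hb0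
  have hB : 0 ≤ (L : ℝ) ^ 3 * β := by positivity
  set K1 : ℝ := transferKernel su2Rep ((L : ℝ) ^ 3 * β) (1 : GaugeConfig 3 1 SU2) 1 with hK1
  have hK1pos : 0 < K1 := transferKernel_pos _ _ _ _
  have h := hkop_oneSite hB a b ha hb hCa hCb ha0 hb0
  have e : ∫ u, ∫ u', a u * (transferKernel su2Rep ((L : ℝ) ^ 3 * β) u u' / K1) * b u' ∂configMeasure SU2 1 ∂configMeasure SU2 1 =
      (∫ u, ∫ u', a u * transferKernel su2Rep ((L : ℝ) ^ 3 * β) u u' * b u' ∂configMeasure SU2 1 ∂configMeasure SU2 1) / K1 := by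
    rw [← integral_div]
    refine integral_congr_ae (ae_of_all _ fun u => ?_)
    show ∫ u', a u * (transferKernel su2Rep ((L : ℝ) ^ 3 * β) u u' / K1) * b u' ∂configMeasure SU2 1 =
      (∫ u', a u * transferKernel su2Rep ((L : ℝ) ^ 3 * β) u u' * b u' ∂configMeasure SU2 1) / K1
    rw [← integral_div]
    refine integral_congr_ae (ae_of_all _ fun u' => ?_)
    show a u * (transferKernel su2Rep ((L : ℝ) ^ 3 * β) u u' / K1) * b u' = a u * transferKernel su2Rep ((L : ℝ) ^ 3 * β) u u' * b u' / K1
    ring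
  rw [e, div_le_iff₀ hK1pos]
  calc _ ≤ _ := h
    _ = _ := by field_simp

end Summit.QuantumFields.YangMills.Theorems.FemtoTransferGap.TwoLattice.ConstTube

end
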